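/-
Copyright (c) 2026 the pub-hodgecm-mathlib formalisation cell (harness21).  Prover seat hodgecm-mathlib-K2Liu-p06 (g2): Track B «K2-LIT»,
#184♮ = hLiu418 = stmt-HodgeConjecture-24832; organ O33.5b for socket #33s `sig_K2LiuZetaSNonvanishingData` of the tier-1 socket module
`Cruxes/HLiu418/Lines/K2_Liu_CurveThetaSigs_U5d_ZetaS.lean` (ED. 3, sha16 7c2f436314d56d7b, :426; LEAD F0P6-plan (g10) RE-DEAL 2026-09-04T02:26:33Z); 2026-09-04.
-/
import Summits.HodgeConjecture.HodgeConjecture.Theorems.K2LiuZetaSWeightIntegrable      -- ★ organs O33.2 ∕ O33.3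
import Summits.HodgeConjecture.HodgeConjecture.Theorems.K2LiuZetaSApproximateIdentity   -- ★ organ O33.4a
import Summits.HodgeConjecture.HodgeConjecture.Theorems.K2LiuSectionSmear               -- ★ organ O33.5a
import Mathlib.Algebra.Order.Field.Basic
import HarnessLib

/-!
# Crux `HLiu418`, Track B road `K2_Liu`, unit U5d «`Z_S`», socket #33s — organ O33.5b:
# from a big-cell section `φ♭` to a `K_∞`-finite smear `φ = ρ_η φ♭` with `T_{f_φ}[φ₁] ≠ 0`, hence `Z_S(φ, φ₁, φ₁(g₀•·)) ≠ 0`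

Cell `hodgecm-mathlib`, crux item hLiu418 = `stmt-HodgeConjecture-24832`, route of record `HCCMUnconditional`; squad K2 ∕ K2Liu,
LEAD F0P6-plan (g10), planner K2Liu-plan (g2), prover K2Liu-p06 (g2).  THEOREMS ONLY (no `def`, no instance, no notation, no
named-fact hypothesis, no `sorry`, default heartbeats); lane `--supports stmt-HodgeConjecture-24832` (count-neutral helper).

WHAT IS PROVED.
* §1 (generic `a : 𝕂 →* Γ`, `𝕂` compact): `smear_apply_mul_eq_self_of_commute` — right invariance of `φ` under an element commuting with `a(𝕂)`
  passes to every smear `ρ_η φ`; `exists_isTranslationFinite_forall_norm_smear_sub_le` — **for a continuous `φ`, a compact `A ⊆ Γ` and `ε > 0`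
  there is a left-translation-finite weight `η` (★ Peter–Weyl) with `‖ρ_η φ(h) − φ(h)‖ ≤ ε` on `A`** (bump of mass one inside the uniform-continuity
  neighbourhood, ★ O33.5a, then its translation-finite uniform approximation).
* §2 (doubled unitary frame): `isSiegelDeltaSection_sub`; `exists_const_forall_norm_section_le` — the section-growth constant is UNIFORM:
  `‖ψ(h)‖ ≤ ε · B · Φ(h)^{2 Re s + n}` for EVERY Siegel section `ψ` at `s` with `‖ψ‖ ≤ ε` on `K` (`B = sup_K Φ^{−(2 Re s + n)}`).
* §3 (the frame of socket #33s) `exists_isTranslationFinite_smear_integral_ne_zero` — **THE SMEAR STEP.**  Data: an Iwasawa datum `𝒦`, unitary `χ`,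
  `N/2 − 1 < Re s₀`, a continuous positive height `Φ` of type `(P_Δ, modDelta)` with the socket's sharp decay, `ιA` continuous, a compact Hausdorff
  group `𝕂` with a left-invariant measure positive on opens and a continuous `a : 𝕂 →* H(𝔸)`; a CONTINUOUS Siegel section `φ♭` at `s₀` whose doubling
  weight `f_{φ♭}(x) = φ♭(ι(ιA(p x), 1))` is a REAL weight `g ≥ 0` supported in the good set `{x | ‖[φ₁]‖²/2 < Re ⟪[φ₁], R(p x)[φ₁]⟫}` with `∫ g > 0`,
  `φ₁` continuous on the compact quotient.  Conclusion: for some left-translation-finite `η : C(𝕂, ℂ)` the smear `φ = ρ_η φ♭` has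
  `T_{f_φ}[φ₁] = ∫ f_φ(x) • R(p x)[φ₁] dx ≠ 0` (uniform growth constant §2 + `L¹`-robustness ★ O33.4a
  `integral_smul_rightRegular_ne_zero_of_norm_sub_lt` + smear approximation §1).
  `exists_smear_admissible_zetaS_ne_zero` — the same packaged in the socket's shape: `φ` is a continuous Siegel section at `s₀` (★ O33.5a), `𝒦`-finite
  as soon as every `t ∈ 𝒦.K` factors `t = a(k₀)·u` with `u` commuting with `a(𝕂)` and `φ♭(·u)` in a finite continuous family (★ `isKFinite_smear`),
  right-invariant under every `u` commuting with `a(𝕂)` that fixes `φ♭`, and `Z_S(φ, φ₁, φ₁(g₀ • ·)) ≠ 0` for some `g₀` (★ O33.2∕O33.3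
  `exists_zetaS_translate_ne_zero_of_section`).
WHAT REMAINS FOR #33s after this file: (O33.4b∕O33.6) the CONSTRUCTION of such a `φ♭` (a continuous Siegel section at `s₀` supported in the big cell
`P_Δ·ι(U × 1)·K′` with prescribed non-negative weight near `1`, unramified `Λ_{s₀,v}` off `S`), and (O33.7) the bookkeeping that ★ #31p's
`iwasawaDatumAdapted` factors through `𝕂 = K_{𝒦,∞}` as required, with `K^S_H ⊆ 𝒦.K`.

HONEST LABEL.  Count-neutral scaffold file of the K2_Liu road; it pays nothing by itself: `HC_CM` is proved only modulo the 7 printed citations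
(2 remaining named inputs: hLiu418 = `stmt-HodgeConjecture-24832`, h413 = `stmt-HodgeConjecture-24833`) until rung 0 closes.

## References
* [Liu2011] Y. Liu, Algebra Number Theory 5 (2011): §2C (2-5) pp. 863–864 (non-vanishing of the doubling zeta integral on good `K`-finite sections).
* [HarrisKudlaSweet1996] M. Harris, S. Kudla, W. J. Sweet, JAMS 9 (1996): Thm. 4.3 (i) p. 962, (6.27)–(6.28) p. 973.
* [BorelJacquet1979] A. Borel, H. Jacquet, PSPM 33.1 (1979): §4.1, §4.6.
* [BrockerTomDieck1985] T. Bröcker, T. tom Dieck (1985): III (3.1), (5.6)–(5.7).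
-/

set_option autoImplicit false
set_option linter.dupNamespace false

noncomputable section

open scoped InnerProductSpace Topology
open MeasureTheory Filter

namespace Summit.HodgeConjecture.HodgeConjecture.Cruxes.HLiu418.K2LiuZetaSKFiniteSmear

open Literature.NumberTheory.Automorphic Literature.NumberTheory.GaloisRepresentations
open Literature.NumberTheory.GelbartRogawski1991 Literature.NumberTheory.GelbartRogawski1991.GRConstruction
open Literature.NumberTheory.K2Lit.PlaceSplitting Literature.NumberTheory.K2Lit.SiegelDoubled
open Summit.HodgeConjecture.HodgeConjecture.Cruxes.HLiu418.K2LiuZetaSInnerProduct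
open Summit.HodgeConjecture.HodgeConjecture.Cruxes.HLiu418.K2LiuZetaSWeightIntegrable
open Summit.HodgeConjecture.HodgeConjecture.Cruxes.HLiu418.K2LiuZetaSApproximateIdentity
open Summit.HodgeConjecture.HodgeConjecture.Cruxes.HLiu418.K2LiuSectionSmear

/-! ### §1 Generic complements on the smear -/

section Generic

variable {Γ : Type*} [Group Γ] [TopologicalSpace Γ] [IsTopologicalGroup Γ]
  {𝕂 : Type*} [Group 𝕂] [TopologicalSpace 𝕂] [IsTopologicalGroup 𝕂] [CompactSpace 𝕂] [T2Space 𝕂]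
  [MeasurableSpace 𝕂] [BorelSpace 𝕂] (ν : Measure 𝕂) [IsFiniteMeasureOnCompacts ν]
  (a : 𝕂 →* Γ) (ha : Continuous a)

omit [TopologicalSpace Γ] [IsTopologicalGroup Γ] [TopologicalSpace 𝕂] [IsTopologicalGroup 𝕂] [CompactSpace 𝕂] [T2Space 𝕂]
  [BorelSpace 𝕂] [IsFiniteMeasureOnCompacts ν] in
/-- **Right invariance passes to the smear**: if `u` commutes with `a(𝕂)` and `φ(h u) = φ(h)` for all `h`, then `(ρ_η φ)(h u) = (ρ_η φ)(h)`.
[cite: BorelJacquet1979, §4.1] -/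
theorem smear_apply_mul_eq_self_of_commute (φ : Γ → ℂ) (η : 𝕂 → ℂ) {u : Γ} (hu : ∀ k, u * a k = a k * u)
    (hφ : ∀ h, φ (h * u) = φ h) (h : Γ) :
    (∫ k, η k * φ (h * u * a k) ∂ν) = ∫ k, η k * φ (h * a k) ∂ν := by
  refine integral_congr_ae (Eventually.of_forall fun k => ?_)
  change η k * φ (h * u * a k) = η k * φ (h * a k)
  rw [mul_assoc, hu k, ← mul_assoc, hφ]

include ha in
/-- **Translation-finite smears approximate uniformly on compacts.**  For a continuous `φ : Γ → ℂ`, a compact `A ⊆ Γ` and `ε > 0` there is a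
left-translation-finite `η : C(𝕂, ℂ)` (★ Peter–Weyl) with `‖(ρ_η φ)(h) − φ(h)‖ ≤ ε` for all `h ∈ A`: take a bump `ηb ≥ 0` of mass one inside the
uniform-continuity neighbourhood of `1` (error `ε/2`), then `η` uniformly `δ`-close to `ηb` with `δ · sup_{A·a(𝕂)} ‖φ‖ · ν(𝕂) < ε/2`.
[cite: BrockerTomDieck1985, III (3.1), (5.7)] [cite: BorelJacquet1979, §4.1] -/
theorem exists_isTranslationFinite_forall_norm_smear_sub_le [ν.IsOpenPosMeasure] {φ : Γ → ℂ} (hφ : Continuous φ) {A : Set Γ}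
    (hA : IsCompact A) {ε : ℝ} (hε : 0 < ε) :
    ∃ η : C(𝕂, ℂ), IsTranslationFinite η ∧ ∀ h ∈ A, ‖(∫ k, η k * φ (h * a k) ∂ν) - φ h‖ ≤ ε := by
  rcases A.eq_empty_or_nonempty with rfl | ⟨h₀, hh₀⟩
  · exact ⟨0, IsTranslationFinite.zero, fun h hh => (Set.notMem_empty h hh).elim⟩
  -- a uniform bound `M` for `φ` on `A · a(𝕂)`
  obtain ⟨M, hM⟩ := (hA.prod isCompact_univ).exists_bound_of_continuousOn (f := fun q : Γ × 𝕂 => φ (q.1 * a q.2))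
    ((hφ.comp (continuous_fst.mul (ha.comp continuous_snd))).continuousOn)
  have hM' : ∀ h ∈ A, ∀ k : 𝕂, ‖φ (h * a k)‖ ≤ M := fun h hh k => hM (h, k) ⟨hh, Set.mem_univ k⟩
  -- uniform continuity along `a(𝕂)` on `A`, error `ε/2`
  obtain ⟨V, hV, hVε⟩ := exists_nhds_forall_norm_sub_lt a ha hφ hA (half_pos hε)
  obtain ⟨V', hV'V, hV'o, h1V'⟩ := mem_nhds_iff.1 hV
  obtain ⟨ηb, hηb0, hηb1, hηbV⟩ := exists_continuous_nonneg_integral_eq_one ν hV'o h1V'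
  have hηbi : Integrable (fun k => ηb k) ν := ηb.continuous.integrable_of_hasCompactSupport (HasCompactSupport.of_compactSpace _)
  -- the translation-finite approximation of the bump
  obtain ⟨δ, hδ0, hδ⟩ := exists_pos_mul_lt (half_pos hε) (M * ν.real Set.univ)
  let ηbc : C(𝕂, ℂ) := ⟨fun k => (ηb k : ℂ), Complex.continuous_ofReal.comp ηb.continuous⟩
  obtain ⟨η, hηtf, hηδ⟩ := exists_isTranslationFinite_forall_norm_sub_lt ηbc hδ0
  refine ⟨η, hηtf, fun h hh => ?_⟩
  have hint1 : Integrable (fun k => η k * φ (h * a k)) ν := integrable_mul_comp_smear ν a ha hφ η h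
  have hint2 : Integrable (fun k => (ηb k : ℂ) * φ (h * a k)) ν := integrable_mul_comp_smear ν a ha hφ ηbc h
  have hA1 : ‖(∫ k, η k * φ (h * a k) ∂ν) - ∫ k, (ηb k : ℂ) * φ (h * a k) ∂ν‖ ≤ δ * M * ν.real Set.univ :=
    norm_smear_sub_smear_le ν a φ h hint1 hint2 (fun k => (hηδ k).le) (hM' h hh)
  have hA2 : ‖(∫ k, (ηb k : ℂ) * φ (h * a k) ∂ν) - φ h‖ ≤ ε / 2 :=
    norm_smear_sub_le_of_forall ν a φ (fun k => hηb0 k) hηbi hηb1 h hint2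
      (fun k hk => (hVε k (hV'V (hηbV k hk)) h hh).le)
  calc ‖(∫ k, η k * φ (h * a k) ∂ν) - φ h‖
      ≤ ‖(∫ k, η k * φ (h * a k) ∂ν) - ∫ k, (ηb k : ℂ) * φ (h * a k) ∂ν‖ +
          ‖(∫ k, (ηb k : ℂ) * φ (h * a k) ∂ν) - φ h‖ := norm_sub_le_norm_sub_add_norm_sub _ _ _
    _ ≤ δ * M * ν.real Set.univ + ε / 2 := add_le_add hA1 hA2
    _ ≤ ε / 2 + ε / 2 := by nlinarith
    _ = ε := add_halves ε

end Generic

/-! ### §2 Uniform growth constant for Siegel sections -/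

section Growth

open NumberField

variable (L : Type) [Field L] [NumberField L] [IsCMField L]
variable {N M n : ℕ} (e : Fin N × Fin M ≃ Fin n)
  (dV : Fin N → L) (hdV : ∀ i, IsCMField.complexConj L (dV i) = dV i)
  (dW : Fin M → L) (hdW : ∀ i, IsCMField.complexConj L (dW i) = dW i)

/-- Siegel sections at `s` form a subspace: differences of sections are sections. [cite: Tan1999, §1] -/
theorem isSiegelDeltaSection_sub (χ : HeckeCharacter L) (s : ℂ) {φ ψ : HA L e dV hdV dW hdW → ℂ}
    (hφ : IsSiegelDeltaSection L e dV hdV dW hdW χ s φ) (hψ : IsSiegelDeltaSection L e dV hdV dW hdW χ s ψ) :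
    IsSiegelDeltaSection L e dV hdV dW hdW χ s fun h => φ h - ψ h := by
  intro p hp h
  change φ (p * h) - ψ (p * h) = _ * (φ h - ψ h)
  rw [hφ p hp h, hψ p hp h, mul_sub]

/-- **Uniform section growth.** For an Iwasawa datum `𝒦`, a unitary `χ` and a continuous positive height `Φ` of type `(P_Δ, modDelta)` there is
`B ≥ 0` such that EVERY Siegel section `ψ` at `s` with `‖ψ‖ ≤ ε` on `K` satisfies `‖ψ(h)‖ ≤ ε · B · Φ(h)^{2 Re s + n}` on all of `H(𝔸)`
(`B = sup_K Φ^{−(2 Re s + n)}`; no continuity of `ψ` is needed). [cite: Liu2011, §2B Prop. 2.3 p. 862] [cite: Tan1999, §1] -/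
theorem exists_const_forall_norm_section_le (𝒦 : IwasawaDatum L e dV hdV dW hdW) {χ : HeckeCharacter L} (hχu : χ.IsUnitary) (s : ℂ)
    {Φ : HA L e dV hdV dW hdW → ℝ} (hΦc : Continuous Φ) (hΦpos : ∀ x, 0 < Φ x)
    (hΦ : ∀ p x : HA L e dV hdV dW hdW, IsSiegelDelta L e dV hdV dW hdW p → Φ (p * x) = modDelta L e dV hdV dW hdW p * Φ x) :
    ∃ B : ℝ, 0 ≤ B ∧ ∀ ψ : HA L e dV hdV dW hdW → ℂ, IsSiegelDeltaSection L e dV hdV dW hdW χ s ψ →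
      ∀ ε : ℝ, (∀ k ∈ 𝒦.K, ‖ψ k‖ ≤ ε) → ∀ h : HA L e dV hdV dW hdW, ‖ψ h‖ ≤ ε * B * Φ h ^ (2 * s.re + (n : ℝ)) := by
  obtain ⟨C, hC⟩ := 𝒦.isCompact_K.exists_bound_of_continuousOn
    (f := fun k : HA L e dV hdV dW hdW => Φ k ^ (-(2 * s.re + (n : ℝ))))
    ((hΦc.rpow_const fun x => Or.inl (hΦpos x).ne').continuousOn)
  refine ⟨max C 0, le_max_right _ _, fun ψ hψ ε hε h => ?_⟩
  obtain ⟨p, k, hp, hk, rfl⟩ := 𝒦.iwasawa h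
  have hΦk : 0 < Φ k := hΦpos k
  have hε0 : 0 ≤ ε := (norm_nonneg _).trans (hε k hk)
  have hmod : modDelta L e dV hdV dW hdW p = Φ (p * k) / Φ k := by
    rw [hΦ p k hp, mul_div_cancel_right₀ _ hΦk.ne']
  have hbd : Φ k ^ (-(2 * s.re + (n : ℝ))) ≤ max C 0 := by
    have h1 := hC k hk
    rw [Real.norm_of_nonneg (Real.rpow_nonneg hΦk.le _)] at h1
    exact h1.trans (le_max_left _ _)
  rw [norm_section_mul_eq L e dV hdV dW hdW hχu s hψ hp k, hmod, Real.div_rpow (hΦpos _).le hΦk.le]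
  rw [Real.rpow_neg hΦk.le] at hbd
  calc Φ (p * k) ^ (2 * s.re + (n : ℝ)) / Φ k ^ (2 * s.re + (n : ℝ)) * ‖ψ k‖
      = Φ (p * k) ^ (2 * s.re + (n : ℝ)) * ((Φ k ^ (2 * s.re + (n : ℝ)))⁻¹ * ‖ψ k‖) := by ring
    _ ≤ Φ (p * k) ^ (2 * s.re + (n : ℝ)) * (max C 0 * ε) :=
        mul_le_mul_of_nonneg_left (mul_le_mul hbd (hε k hk) (norm_nonneg _) (le_max_right _ _))
          (Real.rpow_nonneg (hΦpos _).le _)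
    _ = ε * max C 0 * Φ (p * k) ^ (2 * s.re + (n : ℝ)) := by ring

end Growth

/-! ### §3 The smear step in the frame of socket #33s -/

section Frame

open NumberField IsDedekindDomain

variable (L : Type) [Field L] [NumberField L] [IsCMField L]
variable {N n : ℕ} (e : Fin N × Fin 1 ≃ Fin n)
  (dV : Fin N → L) (hdV : ∀ i, IsCMField.complexConj L (dV i) = dV i)
  (dW : Fin 1 → L) (hdW : ∀ i, IsCMField.complexConj L (dW i) = dW i)
  (H : Matrix (Fin N) (Fin N) L)
  (S : Finset (HeightOneSpectrum (𝓞 (Fp L)))) [DecidableEq (HeightOneSpectrum (𝓞 (Fp L)))]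
  (ιA : (UnitaryGroup.adelicGroupData (Fp L) L (IsCMField.complexConj L) N H).Adelic →*
    UnitaryGroup.adelic (Fp L) L (IsCMField.complexConj L) N (Matrix.diagonal dV))
  [MeasurableSpace (UnitaryGroup.arch (Fp L) L (IsCMField.complexConj L) N H)]
  [BorelSpace (UnitaryGroup.arch (Fp L) L (IsCMField.complexConj L) N H)]
  [∀ v : HeightOneSpectrum (𝓞 (Fp L)), MeasurableSpace (UnitaryGroup.localPi L (IsCMField.complexConj L) N H v)]
  [∀ v : HeightOneSpectrum (𝓞 (Fp L)), BorelSpace (UnitaryGroup.localPi L (IsCMField.complexConj L) N H v)]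
  (νinf : Measure (UnitaryGroup.arch (Fp L) L (IsCMField.complexConj L) N H))
  (νS : ∀ v : S, Measure (UnitaryGroup.localPi L (IsCMField.complexConj L) N H v.1))
  (μ : Measure (UnitaryGroup.adelicGroupData (Fp L) L (IsCMField.complexConj L) N H).automorphicQuotient)
  [(UnitaryGroup.adelicGroupData (Fp L) L (IsCMField.complexConj L) N H).IsAutomorphicMeasure μ]
  [CompactSpace (UnitaryGroup.adelicGroupData (Fp L) L (IsCMField.complexConj L) N H).automorphicQuotient]
  {𝕂 : Type*} [Group 𝕂] [TopologicalSpace 𝕂] [IsTopologicalGroup 𝕂] [CompactSpace 𝕂] [T2Space 𝕂]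
  [MeasurableSpace 𝕂] [BorelSpace 𝕂] (ν𝕂 : Measure 𝕂) [IsFiniteMeasureOnCompacts ν𝕂] [ν𝕂.IsOpenPosMeasure] [ν𝕂.IsMulLeftInvariant]
  (a : 𝕂 →* HA L e dV hdV dW hdW)

omit [ν𝕂.IsMulLeftInvariant] in
/-- **THE SMEAR STEP.**  In the frame of socket #33s, let `φ♭` be a continuous Siegel section at `s₀` whose doubling weight `f_{φ♭} = φ♭(ι(ιA(p ·), 1))`
is a real weight `g ≥ 0` supported in the good set of `[φ₁]` with `∫ g > 0`.  Then for some left-translation-finite `η : C(𝕂, ℂ)` the smear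
`φ = ρ_η φ♭` along `a : 𝕂 →* H(𝔸)` has `T_{f_φ}[φ₁] ≠ 0`:  `‖f_φ − g‖_{L¹} ≤ (sup_K ‖φ − φ♭‖) · B · ‖Φ(…)^{2 Re s₀ + n}‖_{L¹}` by the UNIFORM growth constant
(§2, `φ − φ♭` is a section) and the decay, `sup_K ‖φ − φ♭‖` is as small as we please (§1), and small `L¹`-perturbations of an approximate identity do
not annihilate (★ O33.4a). [cite: Liu2011, §2C (2-5) pp. 863–864] [cite: HarrisKudlaSweet1996, (6.27)–(6.28) p. 973] -/
theorem exists_isTranslationFinite_smear_integral_ne_zero (ha : Continuous a) (𝒦 : IwasawaDatum L e dV hdV dW hdW)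
    {χ : HeckeCharacter L} (hχu : χ.IsUnitary) {s₀ : ℂ} (hs₀ : (N : ℝ) / 2 - 1 < s₀.re)
    {Φ : HA L e dV hdV dW hdW → ℝ} (hΦc : Continuous Φ) (hΦpos : ∀ x, 0 < Φ x)
    (hΦ : ∀ p x : HA L e dV hdV dW hdW, IsSiegelDelta L e dV hdV dW hdW p → Φ (p * x) = modDelta L e dV hdV dW hdW p * Φ x)
    (hιAc : Continuous ιA)
    (hdecay : ∀ τ : ℝ, 2 * (N : ℝ) - 2 < τ →
      Integrable (fun x => Φ (iotaLeft L e dV hdV dW hdW (ιA (placesEmbed L H S x))) ^ τ) (νinf.prod (Measure.pi νS)))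
    {φb : HA L e dV hdV dW hdW → ℂ} (hφb : IsSiegelDeltaSection L e dV hdV dW hdW χ s₀ φb) (hφbc : Continuous φb)
    {g : UnitaryGroup.arch (Fp L) L (IsCMField.complexConj L) N H ×
        (Π v : S, UnitaryGroup.localPi L (IsCMField.complexConj L) N H v.1) → ℝ}
    (hg0 : 0 ≤ g) (hgφ : ∀ x, φb (iotaLeft L e dV hdV dW hdW (ιA (placesEmbed L H S x))) = (g x : ℂ))
    {φ₁ : (UnitaryGroup.adelicGroupData (Fp L) L (IsCMField.complexConj L) N H).automorphicQuotient → ℂ} (hφ₁ : Continuous φ₁)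
    (hsupp : Function.support g ⊆ {x | ‖(memLp_two_of_continuous _ μ hφ₁).toLp φ₁‖ ^ 2 / 2 <
        RCLike.re ⟪(memLp_two_of_continuous _ μ hφ₁).toLp φ₁,
          (UnitaryGroup.adelicGroupData (Fp L) L (IsCMField.complexConj L) N H).rightRegular μ (placesEmbed L H S x)
            ((memLp_two_of_continuous _ μ hφ₁).toLp φ₁)⟫_ℂ})
    (hpos : 0 < ∫ x, g x ∂(νinf.prod (Measure.pi νS))) :
    ∃ η : C(𝕂, ℂ), IsTranslationFinite η ∧
      (∫ x, (fun h => ∫ k, η k * φb (h * a k) ∂ν𝕂) (iotaLeft L e dV hdV dW hdW (ιA (placesEmbed L H S x))) •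
          (UnitaryGroup.adelicGroupData (Fp L) L (IsCMField.complexConj L) N H).rightRegular μ (placesEmbed L H S x)
            ((memLp_two_of_continuous _ μ hφ₁).toLp φ₁)
        ∂(νinf.prod (Measure.pi νS))) ≠ 0 := by
  -- freeze the `L²` class of `φ₁`
  generalize (memLp_two_of_continuous _ μ hφ₁).toLp φ₁ = F at hsupp ⊢
  -- the admissible exponent and the decay integral
  have hn : (n : ℝ) = N := by exact_mod_cast (show n = N by simpa using (Fintype.card_congr e).symm)
  have hτ : 2 * (N : ℝ) - 2 < 2 * s₀.re + (n : ℝ) := by rw [hn]; linarith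
  have hIΦ := hdecay _ hτ
  -- `F ≠ 0` (the good set of `0` is empty, but `g` has positive mass)
  have hF0 : F ≠ 0 := by
    intro h0
    have hsupp0 : Function.support g ⊆ ∅ := by
      refine hsupp.trans fun x hx => ?_
      rw [h0] at hx
      simp only [norm_zero, inner_zero_left, map_zero, Set.mem_setOf_eq] at hx
      norm_num at hx
    have hg : g = 0 := Function.support_eq_empty_iff.1 (Set.subset_empty_iff.1 hsupp0)
    rw [hg] at hpos
    simp at hpos
  have hc₀ : 0 < ‖F‖ / 2 * ∫ x, g x ∂(νinf.prod (Measure.pi νS)) :=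
    mul_pos (half_pos (norm_pos_iff.2 hF0)) hpos
  -- the uniform growth constant and the room `ε`
  obtain ⟨B, hB0, hB⟩ := exists_const_forall_norm_section_le L e dV hdV dW hdW 𝒦 hχu s₀ hΦc hΦpos hΦ
  obtain ⟨ε, hε0, hε⟩ := exists_pos_mul_lt hc₀
    (B * (∫ x, Φ (iotaLeft L e dV hdV dW hdW (ιA (placesEmbed L H S x))) ^ (2 * s₀.re + (n : ℝ)) ∂(νinf.prod (Measure.pi νS))) * ‖F‖)
  -- the translation-finite smear, `ε`-close to `φ♭` on `K`
  obtain ⟨η, hηtf, hηK⟩ := exists_isTranslationFinite_forall_norm_smear_sub_le ν𝕂 a ha hφbc 𝒦.isCompact_K hε0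
  refine ⟨η, hηtf, ?_⟩
  have hφsec : IsSiegelDeltaSection L e dV hdV dW hdW χ s₀ (fun h => ∫ k, η k * φb (h * a k) ∂ν𝕂) :=
    isSiegelDeltaSection_smear L e dV hdV dW hdW ν𝕂 a χ s₀ hφb (fun k => η k)
  have hφc : Continuous fun h => ∫ k, η k * φb (h * a k) ∂ν𝕂 := continuous_smear ν𝕂 a ha hφbc η
  -- pointwise bound for the difference section
  have hψ := isSiegelDeltaSection_sub L e dV hdV dW hdW χ s₀ hφsec hφb
  have hψb : ∀ h, ‖(∫ k, η k * φb (h * a k) ∂ν𝕂) - φb h‖ ≤ ε * B * Φ h ^ (2 * s₀.re + (n : ℝ)) :=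
    hB _ hψ ε hηK
  -- integrability of the two weights
  have hfbi := integrable_doublingWeight_of_decay L e dV hdV dW hdW H S ιA νinf νS 𝒦 hχu hs₀ hφb hφbc hΦc hΦpos hΦ hιAc hdecay
  have hfi := integrable_doublingWeight_of_decay L e dV hdV dW hdW H S ιA νinf νS 𝒦 hχu hs₀ hφsec hφc hΦc hΦpos hΦ hιAc hdecay
  have hgi : Integrable g (νinf.prod (Measure.pi νS)) := by
    have h1 := (hfbi.congr (Eventually.of_forall fun x => hgφ x)).re
    simpa using h1
  have hintb : Integrable (fun x => (g x : ℂ) •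
      (UnitaryGroup.adelicGroupData (Fp L) L (IsCMField.complexConj L) N H).rightRegular μ (placesEmbed L H S x) F)
      (νinf.prod (Measure.pi νS)) :=
    (integrable_section_smul_rightRegular L e dV hdV dW hdW H S νinf νS μ ιA φb F hfbi).congr
      (Eventually.of_forall fun x => by simp only [hgφ])
  have hint := integrable_section_smul_rightRegular L e dV hdV dW hdW H S νinf νS μ ιA
    (fun h => ∫ k, η k * φb (h * a k) ∂ν𝕂) F hfi
  -- the `L¹` estimate
  have hL1 : (∫ x, ‖(fun h => ∫ k, η k * φb (h * a k) ∂ν𝕂) (iotaLeft L e dV hdV dW hdW (ιA (placesEmbed L H S x))) - (g x : ℂ)‖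
      ∂(νinf.prod (Measure.pi νS))) * ‖F‖ < ‖F‖ / 2 * ∫ x, g x ∂(νinf.prod (Measure.pi νS)) := by
    have h1 : (∫ x, ‖(fun h => ∫ k, η k * φb (h * a k) ∂ν𝕂) (iotaLeft L e dV hdV dW hdW (ιA (placesEmbed L H S x))) - (g x : ℂ)‖
        ∂(νinf.prod (Measure.pi νS))) ≤
        ε * B * ∫ x, Φ (iotaLeft L e dV hdV dW hdW (ιA (placesEmbed L H S x))) ^ (2 * s₀.re + (n : ℝ)) ∂(νinf.prod (Measure.pi νS)) := by
      rw [← integral_const_mul]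
      refine integral_mono_of_nonneg (Eventually.of_forall fun x => norm_nonneg _) (hIΦ.const_mul _)
        (Eventually.of_forall fun x => ?_)
      change ‖(∫ k, η k * φb (iotaLeft L e dV hdV dW hdW (ιA (placesEmbed L H S x)) * a k) ∂ν𝕂) - (g x : ℂ)‖ ≤ _
      rw [← hgφ x]
      exact hψb _
    calc (∫ x, ‖(fun h => ∫ k, η k * φb (h * a k) ∂ν𝕂) (iotaLeft L e dV hdV dW hdW (ιA (placesEmbed L H S x))) - (g x : ℂ)‖
          ∂(νinf.prod (Measure.pi νS))) * ‖F‖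
        ≤ (ε * B * ∫ x, Φ (iotaLeft L e dV hdV dW hdW (ιA (placesEmbed L H S x))) ^ (2 * s₀.re + (n : ℝ))
            ∂(νinf.prod (Measure.pi νS))) * ‖F‖ := mul_le_mul_of_nonneg_right h1 (norm_nonneg _)
      _ = B * (∫ x, Φ (iotaLeft L e dV hdV dW hdW (ιA (placesEmbed L H S x))) ^ (2 * s₀.re + (n : ℝ))
            ∂(νinf.prod (Measure.pi νS))) * ‖F‖ * ε := by ring
      _ < ‖F‖ / 2 * ∫ x, g x ∂(νinf.prod (Measure.pi νS)) := hε
  exact integral_smul_rightRegular_ne_zero_of_norm_sub_lt _ μ (νinf.prod (Measure.pi νS)) (placesEmbed L H S) hgi hg0 hsupp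
    hintb hint hL1

include ν𝕂 in
/-- **THE SMEAR STEP, socket-shaped.**  Under the hypotheses of `exists_isTranslationFinite_smear_integral_ne_zero`, and given moreover
(i) a factorisation of every `t ∈ 𝒦.K` as `t = a(k₀)·u` with `u` commuting with `a(𝕂)` and `φ♭(·u)` in a finite family of continuous functions, and
(ii) a set `Kinv` of elements commuting with `a(𝕂)` and fixing `φ♭` on the right, there is a CONTINUOUS, `𝒦`-FINITE Siegel section `φ` at `s₀`,
right-invariant under `Kinv`, with `Z_S(φ, φ₁, φ₁(g₀ • ·)) ≠ 0` for some `g₀ ∈ G(𝔸)` (★ O33.5a `isSiegelDeltaSection_smear`, `continuous_smear`,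
`isKFinite_smear`; ★ O33.2∕O33.3 `exists_zetaS_translate_ne_zero_of_section`). [cite: Liu2011, §2C (2-5) pp. 863–864]
[cite: HarrisKudlaSweet1996, Thm. 4.3 (i) p. 962] [cite: BorelJacquet1979, §4.1] -/
theorem exists_smear_admissible_zetaS_ne_zero (ha : Continuous a) (𝒦 : IwasawaDatum L e dV hdV dW hdW)
    {χ : HeckeCharacter L} (hχu : χ.IsUnitary) {s₀ : ℂ} (hs₀ : (N : ℝ) / 2 - 1 < s₀.re)
    {Φ : HA L e dV hdV dW hdW → ℝ} (hΦc : Continuous Φ) (hΦpos : ∀ x, 0 < Φ x)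
    (hΦ : ∀ p x : HA L e dV hdV dW hdW, IsSiegelDelta L e dV hdV dW hdW p → Φ (p * x) = modDelta L e dV hdV dW hdW p * Φ x)
    (hιAc : Continuous ιA)
    (hdecay : ∀ τ : ℝ, 2 * (N : ℝ) - 2 < τ →
      Integrable (fun x => Φ (iotaLeft L e dV hdV dW hdW (ιA (placesEmbed L H S x))) ^ τ) (νinf.prod (Measure.pi νS)))
    {φb : HA L e dV hdV dW hdW → ℂ} (hφb : IsSiegelDeltaSection L e dV hdV dW hdW χ s₀ φb) (hφbc : Continuous φb)
    {ι : Type*} [Finite ι] (φfam : ι → HA L e dV hdV dW hdW → ℂ) (hφfam : ∀ i, Continuous (φfam i))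
    (hK : ∀ t ∈ 𝒦.K, ∃ (k₀ : 𝕂) (u : HA L e dV hdV dW hdW) (i : ι),
      t = a k₀ * u ∧ (∀ k, u * a k = a k * u) ∧ (fun h => φb (h * u)) = φfam i)
    (Kinv : Set (HA L e dV hdV dW hdW)) (hKinv : ∀ u ∈ Kinv, (∀ k, u * a k = a k * u) ∧ ∀ h, φb (h * u) = φb h)
    {g : UnitaryGroup.arch (Fp L) L (IsCMField.complexConj L) N H ×
        (Π v : S, UnitaryGroup.localPi L (IsCMField.complexConj L) N H v.1) → ℝ}
    (hg0 : 0 ≤ g) (hgφ : ∀ x, φb (iotaLeft L e dV hdV dW hdW (ιA (placesEmbed L H S x))) = (g x : ℂ))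
    {φ₁ : (UnitaryGroup.adelicGroupData (Fp L) L (IsCMField.complexConj L) N H).automorphicQuotient → ℂ} (hφ₁ : Continuous φ₁)
    (hsupp : Function.support g ⊆ {x | ‖(memLp_two_of_continuous _ μ hφ₁).toLp φ₁‖ ^ 2 / 2 <
        RCLike.re ⟪(memLp_two_of_continuous _ μ hφ₁).toLp φ₁,
          (UnitaryGroup.adelicGroupData (Fp L) L (IsCMField.complexConj L) N H).rightRegular μ (placesEmbed L H S x)
            ((memLp_two_of_continuous _ μ hφ₁).toLp φ₁)⟫_ℂ})
    (hpos : 0 < ∫ x, g x ∂(νinf.prod (Measure.pi νS))) :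
    ∃ φ : HA L e dV hdV dW hdW → ℂ,
      IsSiegelDeltaSection L e dV hdV dW hdW χ s₀ φ ∧ IsKFinite 𝒦 φ ∧ Continuous φ ∧
      (∀ u ∈ Kinv, ∀ h, φ (h * u) = φ h) ∧
      ∃ g₀ : (UnitaryGroup.adelicGroupData (Fp L) L (IsCMField.complexConj L) N H).Adelic,
        zetaS L e dV hdV dW hdW H S νinf νS μ ιA φ φ₁ (fun y => φ₁ (g₀ • y)) ≠ 0 := by
  obtain ⟨η, hηtf, hne⟩ := exists_isTranslationFinite_smear_integral_ne_zero L e dV hdV dW hdW H S ιA νinf νS μ ν𝕂 a ha 𝒦 hχu hs₀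
    hΦc hΦpos hΦ hιAc hdecay hφb hφbc hg0 hgφ hφ₁ hsupp hpos
  have hφsec : IsSiegelDeltaSection L e dV hdV dW hdW χ s₀ (fun h => ∫ k, η k * φb (h * a k) ∂ν𝕂) :=
    isSiegelDeltaSection_smear L e dV hdV dW hdW ν𝕂 a χ s₀ hφb (fun k => η k)
  have hφc : Continuous fun h => ∫ k, η k * φb (h * a k) ∂ν𝕂 := continuous_smear ν𝕂 a ha hφbc η
  refine ⟨fun h => ∫ k, η k * φb (h * a k) ∂ν𝕂, hφsec,
    isKFinite_smear L e dV hdV dW hdW ν𝕂 a ha 𝒦 φb hηtf φfam hφfam hK, hφc,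
    fun u hu h => smear_apply_mul_eq_self_of_commute ν𝕂 a φb (fun k => η k) (hKinv u hu).1 (hKinv u hu).2 h, ?_⟩
  exact exists_zetaS_translate_ne_zero_of_section L e dV hdV dW hdW H S ιA νinf νS μ 𝒦 hχu hs₀ hφsec hφc hΦc hΦpos hΦ hιAc
    hdecay hφ₁ hne

end Frame

end Summit.HodgeConjecture.HodgeConjecture.Cruxes.HLiu418.K2LiuZetaSKFiniteSmear

end
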